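import Summits.HodgeConjecture.HodgeConjecture.Theorems.PadicSemiregularLiftFermatAnchorAssemblyEulerBaseChangeRank
import Mathlib.RingTheory.WittVector.Domain
import Mathlib.RingTheory.WittVector.DiscreteValuationRing
import Mathlib.RingTheory.WittVector.Identities
import Mathlib.RingTheory.Localization.FractionRing
import Mathlib.RingTheory.Localization.Integer
import Mathlib.LinearAlgebra.LinearIndependent.Lemmas

/-!
# The `ℤ`-graded Hom complex of a pair of graded matrix factorizations, VIII: rank semicontinuity over `𝕎 𝕜` (line `witt-lift-rigid-mf`)

Crux `FermatAnchorAssembly` (stmt-HodgeConjecture-14874), stub `stub_eulerBaseChange`; continues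
`…EulerBaseChangeRank.lean`.

**Upper semicontinuity of rank along `Spec 𝕎 𝕜`.** For a finite family `y` of pairs of polynomial
matrices over the Witt vectors `𝕎 𝕜` of a perfect field `𝕜` of characteristic `p`, the dimension of the
`𝕜`-span of the residues `y mod p` is at most the dimension of the `K`-span of the images in the fraction
field `K = Frac 𝕎 𝕜` (`finrank_span_residue_le`). The proof is the `p`-adic descent: a `K`-linear relation
clears to a `𝕎`-linear one (`IsLocalization.exist_integer_multiples`), whose coefficients are all
divisible by `p` as soon as the residues are `𝕜`-independent; dividing by `p` indefinitely contradicts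
`a = pⁿ b` with `b₀ ≠ 0` (`WittVector.exists_eq_pow_p_mul`). Consequently (`dRank_residue_le`,
`hRank_residue_le`, registered as `hRank_residue_le_hRank_fraction`) the ranks of the differentials of
`(M ⊗ 𝕜, N ⊗ 𝕜)` are at most those of `(M ⊗ K, N ⊗ K)` for data `M, N` over `𝕎 𝕜`.
All `[folklore]`; no named fact, no `sorry`.
-/

-- `Summit.HodgeConjecture.HodgeConjecture.…` is the tree's mandated summit/problem namespace (single-problem summit).
set_option linter.dupNamespace false

noncomputable section

open Finset Module

namespace Summit.HodgeConjecture.HodgeConjecture.Cruxes.FermatAnchorAssembly.WittLiftRigidMf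

variable {ν m : ℕ}

/-! ### Torsion-freeness of pairs of polynomial matrices over a domain -/

/-- Over a domain, `c • z = 0` with `c ≠ 0` forces `z = 0` for pairs of polynomial matrices. [folklore] -/
theorem smul_pair_eq_zero {A : Type} [CommRing A] [IsDomain A] {α β γ δ : Type} {c : A} (hc : c ≠ 0)
    {z : Matrix α β (MvPolynomial (Fin ν) A) × Matrix γ δ (MvPolynomial (Fin ν) A)} (h : c • z = 0) :
    z = 0 := by
  apply ext_entryAt
  intro pos
  have := congrArg (entryAt pos) h
  rw [entryAt_smul, entryAt_zero, MvPolynomial.smul_eq_C_mul, mul_eq_zero] at this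
  rcases this with h1 | h1
  · exact absurd (MvPolynomial.C_eq_zero.mp h1) hc
  · rw [h1, entryAt_zero]

/-! ### Two facts about Witt vectors of a perfect field -/

section Witt

variable (p : ℕ) [Fact p.Prime] {𝕜 : Type} [Field 𝕜] [CharP 𝕜 p] [PerfectRing 𝕜 p]

/-- A Witt vector with vanishing first component is divisible by `p` (perfect residue field). [folklore] -/
theorem WittVector_exists_eq_p_mul_of_coeff_zero (a : WittVector p 𝕜) (h : a.coeff 0 = 0) :
    ∃ a' : WittVector p 𝕜, a = (p : WittVector p 𝕜) * a' := by
  by_cases ha : a = 0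
  · exact ⟨0, by simp [ha]⟩
  obtain ⟨n, b, hb, rfl⟩ := WittVector.exists_eq_pow_p_mul a ha
  cases n with
  | zero => simp at h; exact absurd h hb
  | succ k => exact ⟨(p : WittVector p 𝕜) ^ k * b, by ring⟩

/-- A non-zero Witt vector is not infinitely `p`-divisible. [folklore] -/
theorem WittVector_exists_not_pow_dvd (a : WittVector p 𝕜) (ha : a ≠ 0) :
    ∃ N : ℕ, ¬ ((p : WittVector p 𝕜) ^ (N + 1) ∣ a) := by
  obtain ⟨n, b, hb, rfl⟩ := WittVector.exists_eq_pow_p_mul a ha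
  refine ⟨n, ?_⟩
  rintro ⟨c, hc⟩
  have hpn : (p : WittVector p 𝕜) ^ n ≠ 0 := pow_ne_zero n (WittVector.p_nonzero p 𝕜)
  have hbc : b = (p : WittVector p 𝕜) * c := by
    apply mul_left_cancel₀ hpn
    rw [hc, pow_succ, mul_assoc]
  apply hb
  rw [hbc, mul_comm, WittVector.mul_charP_coeff_zero]

/-! ### The `p`-adic descent: residual independence implies generic independence -/

variable {α β γ δ : Type}

/-- **Independent residues ⇒ independent generic images.** For a finite family `y` of pairs of
polynomial matrices over `𝕎 𝕜`: if the residues `y mod p` are `𝕜`-linearly independent then the images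
in `Frac 𝕎 𝕜` are `K`-linearly independent. [folklore] -/
theorem linearIndependent_fraction_of_residue {J : Type} [Fintype J]
    (y : J → Matrix α β (MvPolynomial (Fin ν) (WittVector p 𝕜)) ×
      Matrix γ δ (MvPolynomial (Fin ν) (WittVector p 𝕜)))
    (hLI : LinearIndependent 𝕜
      (fun j ↦ pairMap (WittVector.constantCoeff : WittVector p 𝕜 →+* 𝕜) (y j))) :
    LinearIndependent (FractionRing (WittVector p 𝕜))
      (fun j ↦ pairMap (algebraMap (WittVector p 𝕜) (FractionRing (WittVector p 𝕜))) (y j)) := by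
  classical
  -- (1) every `𝕎`-linear relation has all coefficients ≡ 0 mod p
  have hcoeff : ∀ c : J → WittVector p 𝕜, (∑ j, c j • y j = 0) → ∀ j, (c j).coeff 0 = 0 := by
    intro c hc j
    have h1 : ∑ j, (WittVector.constantCoeff (c j) : 𝕜) •
        pairMap (WittVector.constantCoeff : WittVector p 𝕜 →+* 𝕜) (y j) = 0 := by
      have := congrArg (pairMap (ν := ν) (α := α) (β := β) (γ := γ) (δ := δ)
        (WittVector.constantCoeff : WittVector p 𝕜 →+* 𝕜)) hc
      rw [map_sum, map_zero] at this
      simpa only [pairMap_smul] using this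
    have := Fintype.linearIndependent_iff.mp hLI _ h1 j
    simpa using this
  -- (2) hence every `𝕎`-linear relation has all coefficients divisible by every power of p
  have hdiv : ∀ (N : ℕ) (c : J → WittVector p 𝕜), (∑ j, c j • y j = 0) → ∀ j, (p : WittVector p 𝕜) ^ (N + 1) ∣ c j := by
    intro N
    induction N with
    | zero =>
      intro c hc j
      obtain ⟨c', hc'⟩ := WittVector_exists_eq_p_mul_of_coeff_zero p (c j) (hcoeff c hc j)
      exact ⟨c', by rw [zero_add, pow_one]; exact hc'⟩
    | succ N ih =>
      intro c hc j
      choose c' hc' using fun j ↦ WittVector_exists_eq_p_mul_of_coeff_zero p (c j) (hcoeff c hc j)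
      have hc'rel : ∑ j, c' j • y j = 0 := by
        have h2 : (p : WittVector p 𝕜) • ∑ j, c' j • y j = 0 := by
          rw [Finset.smul_sum]
          simp_rw [smul_smul, ← hc']
          exact hc
        exact smul_pair_eq_zero (WittVector.p_nonzero p 𝕜) h2
      obtain ⟨d, hd⟩ := ih c' hc'rel j
      exact ⟨d, by rw [hc' j, hd]; ring⟩
  -- (3) clear denominators in a `K`-linear relation
  rw [Fintype.linearIndependent_iff]
  intro g hg
  by_contra hne
  push Not at hne
  obtain ⟨j₀, hj₀⟩ := hne
  obtain ⟨b, hb⟩ := IsLocalization.exist_integer_multiples (nonZeroDivisors (WittVector p 𝕜)) (Finset.univ : Finset J) g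
  choose a ha using fun j ↦ RingHom.mem_rangeS.mp (hb j (Finset.mem_univ j))
  -- ha j : algebraMap (WittVector p 𝕜) (FractionRing (WittVector p 𝕜)) (a j) = (b : WittVector p 𝕜) • g j
  have hιb : algebraMap (WittVector p 𝕜) (FractionRing (WittVector p 𝕜)) (b : WittVector p 𝕜) ≠ 0 :=
    IsFractionRing.to_map_ne_zero_of_mem_nonZeroDivisors b.2
  have hrel : ∑ j, a j • y j = 0 := by
    apply pairMap_injective (IsFractionRing.injective (WittVector p 𝕜) (FractionRing (WittVector p 𝕜)))
    rw [map_sum, map_zero]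
    simp_rw [pairMap_smul, ha, Algebra.smul_def, mul_smul, ← Finset.smul_sum, hg, smul_zero]
  have ha₀ : a j₀ ≠ 0 := by
    intro h0
    have := ha j₀
    rw [h0, map_zero, Algebra.smul_def] at this
    exact hj₀ ((mul_eq_zero.mp this.symm).resolve_left hιb)
  obtain ⟨N, hN⟩ := WittVector_exists_not_pow_dvd p (a j₀) ha₀
  exact hN (hdiv N a hrel j₀)

/-- **Upper semicontinuity of rank**: `dim_𝕜 span (y mod p) ≤ dim_K span (y ⊗ K)` for a finite family
`y` of pairs of polynomial matrices over `𝕎 𝕜`. [folklore] -/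
theorem finrank_span_residue_le {J : Type} [Fintype J]
    (y : J → Matrix α β (MvPolynomial (Fin ν) (WittVector p 𝕜)) ×
      Matrix γ δ (MvPolynomial (Fin ν) (WittVector p 𝕜))) :
    finrank 𝕜 (Submodule.span 𝕜
        (Set.range (fun j ↦ pairMap (WittVector.constantCoeff : WittVector p 𝕜 →+* 𝕜) (y j)))) ≤
      finrank (FractionRing (WittVector p 𝕜)) (Submodule.span (FractionRing (WittVector p 𝕜))
        (Set.range (fun j ↦ pairMap (algebraMap (WittVector p 𝕜) (FractionRing (WittVector p 𝕜))) (y j)))) := by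
  classical
  obtain ⟨κ, a, ha, hspan, hli⟩ :=
    exists_linearIndependent' (K := 𝕜) (fun j ↦ pairMap (WittVector.constantCoeff : WittVector p 𝕜 →+* 𝕜) (y j))
  haveI : Fintype κ := Fintype.ofInjective a ha
  rw [← hspan, finrank_span_eq_card hli]
  have hli' : LinearIndependent (FractionRing (WittVector p 𝕜))
      (fun k ↦ pairMap (algebraMap (WittVector p 𝕜) (FractionRing (WittVector p 𝕜))) (y (a k))) :=
    linearIndependent_fraction_of_residue p (fun k ↦ y (a k)) hli
  haveI : Module.Finite (FractionRing (WittVector p 𝕜)) (Submodule.span (FractionRing (WittVector p 𝕜))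
      (Set.range (fun j ↦ pairMap (algebraMap (WittVector p 𝕜) (FractionRing (WittVector p 𝕜))) (y j)))) :=
    Module.Finite.span_of_finite (FractionRing (WittVector p 𝕜)) (Set.finite_range _)
  calc Fintype.card κ
      = finrank (FractionRing (WittVector p 𝕜)) (Submodule.span (FractionRing (WittVector p 𝕜)) (Set.range (fun k ↦ pairMap (algebraMap (WittVector p 𝕜) (FractionRing (WittVector p 𝕜))) (y (a k))))) :=
        (finrank_span_eq_card hli').symm
    _ ≤ finrank (FractionRing (WittVector p 𝕜)) (Submodule.span (FractionRing (WittVector p 𝕜)) (Set.range (fun j ↦ pairMap (algebraMap (WittVector p 𝕜) (FractionRing (WittVector p 𝕜))) (y j)))) := by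
        apply Submodule.finrank_mono
        apply Submodule.span_mono
        rintro _ ⟨k, rfl⟩
        exact ⟨a k, rfl⟩

/-! ### Ranks of the differentials: residue fibre ≤ generic fibre -/

namespace GMFData

variable {ι₀ ι₁ κ₀ κ₁ : Type} [Fintype ι₀] [Fintype ι₁] [Fintype κ₀] [Fintype κ₁]

/-- `dRank` over the residue field is at most `dRank` over the fraction field. [folklore] -/
theorem dRank_residue_le (L : AddSubgroup (Fin ν → ZMod m)) (t : ℤ) (M : GMFData (WittVector p 𝕜) ν m ι₀ ι₁)
    (N : GMFData (WittVector p 𝕜) ν m κ₀ κ₁) :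
    dRank L t (M.map (WittVector.constantCoeff : WittVector p 𝕜 →+* 𝕜)) (N.map WittVector.constantCoeff) ≤
      dRank L t (M.map (algebraMap (WittVector p 𝕜) (FractionRing (WittVector p 𝕜))))
        (N.map (algebraMap (WittVector p 𝕜) (FractionRing (WittVector p 𝕜)))) := by
  rw [dRank_baseChange, dRank_baseChange]
  exact finrank_span_residue_le p _

/-- `hRank` over the residue field is at most `hRank` over the fraction field. [folklore] -/
theorem hRank_residue_le (L : AddSubgroup (Fin ν → ZMod m)) (t : ℤ) (M : GMFData (WittVector p 𝕜) ν m ι₀ ι₁)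
    (N : GMFData (WittVector p 𝕜) ν m κ₀ κ₁) :
    hRank L t (M.map (WittVector.constantCoeff : WittVector p 𝕜 →+* 𝕜)) (N.map WittVector.constantCoeff) ≤
      hRank L t (M.map (algebraMap (WittVector p 𝕜) (FractionRing (WittVector p 𝕜))))
        (N.map (algebraMap (WittVector p 𝕜) (FractionRing (WittVector p 𝕜)))) := by
  rw [hRank_baseChange, hRank_baseChange]
  exact finrank_span_residue_le p _

end GMFData

end Witt

/-- **Registered sub-goal: upper semicontinuity of the rank of the odd differential along `Spec 𝕎 𝕜`.**
For data `M, N` over `𝕎 𝕜` (`𝕜` perfect of characteristic `p`), the rank of `hMap` on odd cochains of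
twist `t` over the residue field `𝕜` is at most the rank over `Frac 𝕎 𝕜`. [folklore] -/
theorem hRank_residue_le_hRank_fraction : ∀ (p : ℕ) [Fact p.Prime] (𝕜 : Type) [Field 𝕜] [CharP 𝕜 p]
    [PerfectRing 𝕜 p] (ν m : ℕ) (L : AddSubgroup (Fin ν → ZMod m)) (ι₀ ι₁ κ₀ κ₁ : Type) [Fintype ι₀]
    [Fintype ι₁] [Fintype κ₀] [Fintype κ₁] (t : ℤ) (M : GMFData (WittVector p 𝕜) ν m ι₀ ι₁)
    (N : GMFData (WittVector p 𝕜) ν m κ₀ κ₁),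
    GMFData.hRank L t (M.map (WittVector.constantCoeff : WittVector p 𝕜 →+* 𝕜))
        (N.map (WittVector.constantCoeff : WittVector p 𝕜 →+* 𝕜)) ≤
      GMFData.hRank L t (M.map (algebraMap (WittVector p 𝕜) (FractionRing (WittVector p 𝕜))))
        (N.map (algebraMap (WittVector p 𝕜) (FractionRing (WittVector p 𝕜)))) :=
  fun p _ _ _ _ _ _ _ L _ _ _ _ _ _ _ _ t M N ↦ GMFData.hRank_residue_le p L t M N

end Summit.HodgeConjecture.HodgeConjecture.Cruxes.FermatAnchorAssembly.WittLiftRigidMf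

end
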